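import Mathlib
import HarnessLib
import Summits.Ventures.LatticeQCDFlow.Exactness.EngineHMCTranslationCovariance
import Summits.Ventures.LatticeQCDFlow.Exactness.AxisPermutationSymmetry
import Summits.Ventures.LatticeQCDFlow.Scoring.WilsonFlowAxisPermutationCovariance

/-!
# The engine's HMC kernels of row 21's arms commute with the axis permutations: the periodic arm with all of them, the open-boundary arm with those fixing the open direction

HONEST FRAMING: exact (Metropolis-corrected) sampling algorithms for lattice gauge theory;
figures of merit are autocorrelation/cost numbers at stated couplings and volumes; no
continuum-physics claim.

Venture `LatticeQCDFlow` (cell pub-lqcd), topic `Exactness`, FANOUT row 21 (`su3-base`, arms `E2 = PBC-HMC` and `OBC-HMC` AS RUN).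
NEW WORK of the cell: the axis-permutation instance of row 21's `EngineHMCTranslationCovariance.conjKernel_sunLeapfrogHMCN_of_equivariant`
(an `n`-step leapfrog HMC kernel commutes with every link relabelling its increment, action and kinetic energy respect), with the
Literature's `configPerm` / `edgePerm` / `wilsonAction_configPerm` (`LatticeGaugeStaticPotentialProofs`), row 21's
`plaquetteLoopSum_configPerm` (`Scoring/WilsonFlowAxisPermutationCovariance`), `obcWeight_sitePerm` / `obcAction_configPerm`
(`AxisPermutationSymmetry`) and `weightedLoopSum` / `sunWeightedForce` (`OpenBoundaryHMCForce`).  Row 21's `Scoring/HMCKernelAxisPermutation`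
is the same statement for row 16's kernel `hmcKernel`; this file is for the engine kernel `sunLeapfrogHMCN` of the arms of record, incl.
the open-boundary arm.  Def-free; nothing is cited as a fact; no number.

* §1 `configPerm_eq_comp` (`configPerm π U = U ∘ (edgePerm π)⁻¹`), `sunWilsonForce_configPerm` (the Wilson force is permutation
  equivariant), **`conjKernel_wilsonForce_sunLeapfrogHMCN_configPerm`** — the periodic arm commutes with EVERY axis permutation.
* §2 `weightedLoopSum_obc_configPerm`, `sunWeightedForce_obc_configPerm` (`π τ = τ`), **`conjKernel_obcForce_sunLeapfrogHMCN_configPerm`**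
  — the open-boundary arm commutes with every axis permutation FIXING the open direction `τ`.
* §3 at every step: the `t`-step laws from permutation-invariant starts are permutation invariant; cold / hot starts qualify;
  **`integral_obcHmcChain_plaquette_configPerm`** — along the open-boundary run the one-point function of `φ(U_{x;ij})` equals that
  of `φ(U_{π⁻¹x; π⁻¹i, π⁻¹j})` for every `π` fixing `τ` (the spatial orientations are interchangeable at every step), and the
  periodic analogue `integral_wilsonHmcChain_plaquette_configPerm`.
* §4 with row 21's translation covariance (`EngineHMCTranslationCovariance`): **`integral_wilsonHmcChain_plaquette_eq_origin`** — along
  the periodic run from a start invariant under all translations and axis permutations (cold, hot), at every step EVERY plaquette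
  `(x; i ≠ j)` has the one-point expectation of the reference plaquette `(0; i₀, j₀)`; hence the LATTICE-AVERAGED plaquette of the
  run check has the single-plaquette expectation at every step (`integral_wilsonHmcChain_plaquetteAverage_eq`; row 21's
  `Scoring/HMCPlaquetteHomogeneity` is the same statement for row 16's kernel).
NOT CLAIMED: reflections of the engine kernel (not a link relabelling: temporal links are inverted); stationarity; numbers.
-/

noncomputable section

namespace Summit.Ventures.LatticeQCDFlow.Exactness

open MeasureTheory ProbabilityTheory ProbabilityTheory.Kernel Set Function
open Literature.MathematicalPhysics.QuantumFieldTheory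
open scoped ENNReal Matrix

set_option backward.isDefEq.respectTransparency false

/-! ## §1 The periodic arm and the axis permutations -/

section Periodic

variable (N : ℕ) {d L : ℕ} [NeZero L]

omit [NeZero L] in
/-- `configPerm π U = U ∘ (edgePerm π)⁻¹`, the relabelling form. -/
theorem configPerm_eq_comp {G : Type*} [MeasurableSpace G] (π : Equiv.Perm (Fin d)) (U : GaugeConfig d L G) :
    configPerm π U = U ∘ (edgePerm (L := L) π).symm := rfl

omit [NeZero L] in
/-- `(edgePerm π)⁻¹ (x, μ) = (sitePerm π⁻¹ x, π⁻¹ μ)`. -/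
theorem edgePerm_symm_apply (π : Equiv.Perm (Fin d)) (x : Site d L) (μ : Fin d) :
    (edgePerm (L := L) π).symm (x, μ) = (sitePerm π.symm x, π.symm μ) := rfl

omit [NeZero L] in
/-- **The Wilson force is permutation equivariant**: `F(U ∘ (edgePerm π)⁻¹) = F(U) ∘ (edgePerm π)⁻¹`. -/
theorem sunWilsonForce_configPerm (β : ℝ) (π : Equiv.Perm (Fin d)) (U : GaugeConfig d L (Matrix.specialUnitaryGroup (Fin N) ℂ)) :
    sunWilsonForce N β (U ∘ (edgePerm (L := L) π).symm) = sunWilsonForce N β U ∘ (edgePerm (L := L) π).symm := by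
  funext e
  obtain ⟨x, μ⟩ := e
  rw [← configPerm_eq_comp]
  simp only [Function.comp_apply, edgePerm_symm_apply, sunWilsonForce, Scoring.plaquetteLoopSum_configPerm]

/-- **THE PERIODIC ARM AS RUN COMMUTES WITH EVERY AXIS PERMUTATION** (every `π`, `β`, `ε`, `nstep`, `L`). -/
theorem conjKernel_wilsonForce_sunLeapfrogHMCN_configPerm (β ε : ℝ) (nstep : ℕ) (π : Equiv.Perm (Fin d)) :
    conjKernel (sunLeapfrogHMCN (sunCoordι N) (sunCoordι_skew N) ε (Measure.addHaar : Measure (SUNCoords N)) (sunKinetic N)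
        (measurable_halfKick_sun N (measurable_sunWilsonForce N (d := d) (L := L) β) ε)
        (fun U => β * wilsonAction (suRep N) U) nstep) (configPerm π) =
      sunLeapfrogHMCN (sunCoordι N) (sunCoordι_skew N) ε (Measure.addHaar : Measure (SUNCoords N)) (sunKinetic N)
        (measurable_halfKick_sun N (measurable_sunWilsonForce N (d := d) (L := L) β) ε)
        (fun U => β * wilsonAction (suRep N) U) nstep :=
  conjKernel_sunLeapfrogHMCN_of_equivariant (sunCoordι N) (sunCoordι_skew N) (edgePerm (L := L) π).symm ε nstep Measure.addHaar
    (measurable_halfKick_sun N (measurable_sunWilsonForce N β) ε)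
    ((continuous_smul_wilsonAction (suRep N) continuous_suRep β).measurable) (measurable_sunKinetic N)
    (configPerm π) (fun U => rfl) (configPerm (G := SUNCoords N) π) (fun p => rfl)
    (fun U => by rw [sunWilsonForce_configPerm]; rfl)
    (fun U => by rw [← configPerm_eq_comp, wilsonAction_configPerm (suRep N) continuous_suRep])
    (fun p => sunKinetic_comp_equiv N (edgePerm (L := L) π).symm p)

end Periodic

/-! ## §2 The open-boundary arm and the axis permutations fixing the open direction -/

section OpenBoundary

variable (N : ℕ) {d L : ℕ} [NeZero L]

omit [NeZero L] in
/-- For `π τ = τ` the open-boundary weighted loop sum is permutation equivariant: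
`Ω^{obc}_{x,μ}(configPerm π V) = Ω^{obc}_{π⁻¹x, π⁻¹μ}(V)`. -/
theorem weightedLoopSum_obc_configPerm {τ : Fin d} (π : Equiv.Perm (Fin d)) (hτ : π τ = τ)
    (V : GaugeConfig d L (Matrix.specialUnitaryGroup (Fin N) ℂ)) (x : Site d L) (μ : Fin d) :
    weightedLoopSum (obcWeight τ) (configPerm π V) x μ = weightedLoopSum (obcWeight τ) V (sitePerm π.symm x) (π.symm μ) := by
  have hτ' : π.symm τ = τ := by rw [Equiv.symm_apply_eq]; exact hτ.symm
  have hsub : ∀ (y : Site d L) (ν : Fin d),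
      sitePerm π.symm (y - Pi.single ν 1) = sitePerm π.symm y - Pi.single (π.symm ν) 1 := fun y ν => by
    rw [sub_eq_add_neg, ← Pi.single_neg, sitePerm_add, sitePerm_single, Pi.single_neg, ← sub_eq_add_neg]
  have hw : ∀ (y : Site d L) (a b : Fin d), plaqWeight (obcWeight τ) (sitePerm π.symm y) (π.symm a) (π.symm b) =
      plaqWeight (obcWeight τ) y a b := by
    intro y a b
    unfold plaqWeight
    by_cases h : a = b
    · rw [dif_pos h, dif_pos (congrArg π.symm h)]
    · rw [dif_neg h, dif_neg (π.symm.injective.ne h)]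
      exact obcWeight_sitePerm π.symm hτ' y a b h
  unfold weightedLoopSum
  simp only [plaquetteHolonomy_configPerm, configPerm_apply]
  refine Fintype.sum_equiv π.symm _ _ fun ν => ?_
  simp only [EmbeddingLike.apply_eq_iff_eq, ← hsub, hw]

omit [NeZero L] in
/-- **The open-boundary force is permutation equivariant for `π τ = τ`**: `F^{obc}(U ∘ (edgePerm π)⁻¹) = F^{obc}(U) ∘ (edgePerm π)⁻¹`. -/
theorem sunWeightedForce_obc_configPerm {τ : Fin d} (π : Equiv.Perm (Fin d)) (hτ : π τ = τ) (β : ℝ)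
    (U : GaugeConfig d L (Matrix.specialUnitaryGroup (Fin N) ℂ)) :
    sunWeightedForce N (obcWeight τ) β (U ∘ (edgePerm (L := L) π).symm) =
      sunWeightedForce N (obcWeight τ) β U ∘ (edgePerm (L := L) π).symm := by
  funext e
  obtain ⟨x, μ⟩ := e
  rw [← configPerm_eq_comp]
  simp only [Function.comp_apply, edgePerm_symm_apply, sunWeightedForce, weightedLoopSum_obc_configPerm N π hτ]

/-- **THE OPEN-BOUNDARY ARM AS RUN COMMUTES WITH EVERY AXIS PERMUTATION FIXING THE OPEN DIRECTION** (`π τ = τ`; every `β`, `ε`,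
`nstep`, `L`). -/
theorem conjKernel_obcForce_sunLeapfrogHMCN_configPerm (τ : Fin d) (β ε : ℝ) (nstep : ℕ) (π : Equiv.Perm (Fin d))
    (hτ : π τ = τ) :
    conjKernel (sunLeapfrogHMCN (sunCoordι N) (sunCoordι_skew N) ε (Measure.addHaar : Measure (SUNCoords N)) (sunKinetic N)
        (measurable_halfKick_sun N (measurable_sunWeightedForce N (d := d) (L := L) (obcWeight τ) β) ε)
        (fun U => β * obcAction (suRep N) τ U) nstep) (configPerm π) =
      sunLeapfrogHMCN (sunCoordι N) (sunCoordι_skew N) ε (Measure.addHaar : Measure (SUNCoords N)) (sunKinetic N)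
        (measurable_halfKick_sun N (measurable_sunWeightedForce N (d := d) (L := L) (obcWeight τ) β) ε)
        (fun U => β * obcAction (suRep N) τ U) nstep :=
  conjKernel_sunLeapfrogHMCN_of_equivariant (sunCoordι N) (sunCoordι_skew N) (edgePerm (L := L) π).symm ε nstep Measure.addHaar
    (measurable_halfKick_sun N (measurable_sunWeightedForce N (obcWeight τ) β) ε)
    ((continuous_obcAction (suRep N) continuous_suRep τ).measurable.const_mul β) (measurable_sunKinetic N)
    (configPerm π) (fun U => rfl) (configPerm (G := SUNCoords N) π) (fun p => rfl)
    (fun U => by rw [sunWeightedForce_obc_configPerm N π hτ]; rfl)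
    (fun U => by rw [← configPerm_eq_comp, obcAction_configPerm π (suRep N) continuous_suRep hτ])
    (fun p => sunKinetic_comp_equiv N (edgePerm (L := L) π).symm p)

end OpenBoundary

/-! ## §3 At every step -/

section Chains

variable (N : ℕ) {d L : ℕ} [NeZero L]

omit [NeZero L] in
/-- The cold start is invariant under every axis permutation. -/
theorem dirac_one_map_configPerm_sun (π : Equiv.Perm (Fin d)) :
    (Measure.dirac (1 : GaugeConfig d L (Matrix.specialUnitaryGroup (Fin N) ℂ))).map (configPerm π) = Measure.dirac 1 := by
  rw [Measure.map_dirac' (configPerm π).measurable]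
  rfl

/-- The hot start is invariant under every axis permutation. -/
theorem piHaar_map_configPerm_sun (π : Equiv.Perm (Fin d)) :
    (Measure.pi fun _ : Edge d L => haarProbability (Matrix.specialUnitaryGroup (Fin N) ℂ)).map (configPerm π) =
      Measure.pi fun _ : Edge d L => haarProbability (Matrix.specialUnitaryGroup (Fin N) ℂ) :=
  (WeightSiteRP.measurePreserving_configPerm (G := Matrix.specialUnitaryGroup (Fin N) ℂ) (L := L) π).map_eq

/-- **Open-boundary arm: the `t`-step law from a start invariant under `configPerm π` (`π τ = τ`) is invariant under it.** -/
theorem obcHmcChain_law_map_configPerm (τ : Fin d) (β ε : ℝ) (nstep : ℕ) {π : Equiv.Perm (Fin d)} (hτ : π τ = τ)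
    {μ₀ : Measure (GaugeConfig d L (Matrix.specialUnitaryGroup (Fin N) ℂ))} (hμ₀ : μ₀.map (configPerm π) = μ₀) (t : ℕ) :
    (μ₀.bind (nHit (sunLeapfrogHMCN (sunCoordι N) (sunCoordι_skew N) ε (Measure.addHaar : Measure (SUNCoords N)) (sunKinetic N)
        (measurable_halfKick_sun N (measurable_sunWeightedForce N (d := d) (L := L) (obcWeight τ) β) ε)
        (fun U => β * obcAction (suRep N) τ U) nstep) t)).map (configPerm π) =
      μ₀.bind (nHit (sunLeapfrogHMCN (sunCoordι N) (sunCoordι_skew N) ε (Measure.addHaar : Measure (SUNCoords N)) (sunKinetic N)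
        (measurable_halfKick_sun N (measurable_sunWeightedForce N (d := d) (L := L) (obcWeight τ) β) ε)
        (fun U => β * obcAction (suRep N) τ U) nstep) t) :=
  Scoring.map_bind_nHit_eq_self (conjKernel_obcForce_sunLeapfrogHMCN_configPerm N τ β ε nstep π hτ) hμ₀ t

/-- **Periodic arm: the `t`-step law from a permutation-invariant start is permutation invariant.** -/
theorem wilsonHmcChain_law_map_configPerm (β ε : ℝ) (nstep : ℕ) (π : Equiv.Perm (Fin d))
    {μ₀ : Measure (GaugeConfig d L (Matrix.specialUnitaryGroup (Fin N) ℂ))} (hμ₀ : μ₀.map (configPerm π) = μ₀) (t : ℕ) :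
    (μ₀.bind (nHit (sunLeapfrogHMCN (sunCoordι N) (sunCoordι_skew N) ε (Measure.addHaar : Measure (SUNCoords N)) (sunKinetic N)
        (measurable_halfKick_sun N (measurable_sunWilsonForce N (d := d) (L := L) β) ε)
        (fun U => β * wilsonAction (suRep N) U) nstep) t)).map (configPerm π) =
      μ₀.bind (nHit (sunLeapfrogHMCN (sunCoordι N) (sunCoordι_skew N) ε (Measure.addHaar : Measure (SUNCoords N)) (sunKinetic N)
        (measurable_halfKick_sun N (measurable_sunWilsonForce N (d := d) (L := L) β) ε)
        (fun U => β * wilsonAction (suRep N) U) nstep) t) :=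
  Scoring.map_bind_nHit_eq_self (conjKernel_wilsonForce_sunLeapfrogHMCN_configPerm N β ε nstep π) hμ₀ t

/-- **Open-boundary run: the spatial orientations are interchangeable at every step** — from any start invariant under the axis
permutations fixing `τ` (cold and hot starts are), `E_t[φ(U_{x;ij})] = E_t[φ(U_{π⁻¹x; π⁻¹i, π⁻¹j})]` for every `π` with `π τ = τ`. -/
theorem integral_obcHmcChain_plaquette_configPerm (τ : Fin d) (β ε : ℝ) (nstep : ℕ)
    {μ₀ : Measure (GaugeConfig d L (Matrix.specialUnitaryGroup (Fin N) ℂ))}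
    (hμ₀ : ∀ π : Equiv.Perm (Fin d), π τ = τ → μ₀.map (configPerm π) = μ₀) (t : ℕ) {F : Type*} [NormedAddCommGroup F]
    [NormedSpace ℝ F] (φ : Matrix.specialUnitaryGroup (Fin N) ℂ → F) {π : Equiv.Perm (Fin d)} (hτ : π τ = τ) (x : Site d L)
    (i j : Fin d) :
    ∫ U, φ (plaquetteHolonomy U x i j) ∂(μ₀.bind (nHit (sunLeapfrogHMCN (sunCoordι N) (sunCoordι_skew N) ε
        (Measure.addHaar : Measure (SUNCoords N)) (sunKinetic N)
        (measurable_halfKick_sun N (measurable_sunWeightedForce N (d := d) (L := L) (obcWeight τ) β) ε)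
        (fun U => β * obcAction (suRep N) τ U) nstep) t)) =
      ∫ U, φ (plaquetteHolonomy U (sitePerm π.symm x) (π.symm i) (π.symm j)) ∂(μ₀.bind (nHit (sunLeapfrogHMCN (sunCoordι N)
        (sunCoordι_skew N) ε (Measure.addHaar : Measure (SUNCoords N)) (sunKinetic N)
        (measurable_halfKick_sun N (measurable_sunWeightedForce N (d := d) (L := L) (obcWeight τ) β) ε)
        (fun U => β * obcAction (suRep N) τ U) nstep) t)) := by
  have h := (MeasurePreserving.mk (configPerm π).measurable
    (obcHmcChain_law_map_configPerm N τ β ε nstep hτ (hμ₀ π hτ) t)).integral_comp' (fun U => φ (plaquetteHolonomy U x i j))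
  simp only [plaquetteHolonomy_configPerm] at h
  exact h.symm

/-- **Periodic run**: `E_t[φ(U_{x;ij})] = E_t[φ(U_{π⁻¹x; π⁻¹i, π⁻¹j})]` for EVERY axis permutation, at every step, from any
permutation-invariant start. -/
theorem integral_wilsonHmcChain_plaquette_configPerm (β ε : ℝ) (nstep : ℕ)
    {μ₀ : Measure (GaugeConfig d L (Matrix.specialUnitaryGroup (Fin N) ℂ))}
    (hμ₀ : ∀ π : Equiv.Perm (Fin d), μ₀.map (configPerm π) = μ₀) (t : ℕ) {F : Type*} [NormedAddCommGroup F] [NormedSpace ℝ F]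
    (φ : Matrix.specialUnitaryGroup (Fin N) ℂ → F) (π : Equiv.Perm (Fin d)) (x : Site d L) (i j : Fin d) :
    ∫ U, φ (plaquetteHolonomy U x i j) ∂(μ₀.bind (nHit (sunLeapfrogHMCN (sunCoordι N) (sunCoordι_skew N) ε
        (Measure.addHaar : Measure (SUNCoords N)) (sunKinetic N)
        (measurable_halfKick_sun N (measurable_sunWilsonForce N (d := d) (L := L) β) ε)
        (fun U => β * wilsonAction (suRep N) U) nstep) t)) =
      ∫ U, φ (plaquetteHolonomy U (sitePerm π.symm x) (π.symm i) (π.symm j)) ∂(μ₀.bind (nHit (sunLeapfrogHMCN (sunCoordι N)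
        (sunCoordι_skew N) ε (Measure.addHaar : Measure (SUNCoords N)) (sunKinetic N)
        (measurable_halfKick_sun N (measurable_sunWilsonForce N (d := d) (L := L) β) ε)
        (fun U => β * wilsonAction (suRep N) U) nstep) t)) := by
  have h := (MeasurePreserving.mk (configPerm π).measurable
    (wilsonHmcChain_law_map_configPerm N β ε nstep π (hμ₀ π) t)).integral_comp' (fun U => φ (plaquetteHolonomy U x i j))
  simp only [plaquetteHolonomy_configPerm] at h
  exact h.symm

end Chains

/-! ## §4 Every plaquette of the periodic run has the same one-point law at every step -/

section Homogeneity

variable (N : ℕ) {d L : ℕ} [NeZero L]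

/-- **EVERY PLAQUETTE HAS THE REFERENCE PLAQUETTE'S EXPECTATION AT EVERY STEP of the periodic run**: from a start invariant under
all translations and all axis permutations, `E_t[φ(U_{x;ij})] = E_t[φ(U_{0;i₀j₀})]` for every site `x`, every `i ≠ j` and any fixed
reference pair `i₀ ≠ j₀`. -/
theorem integral_wilsonHmcChain_plaquette_eq_origin (β ε : ℝ) (nstep : ℕ)
    {μ₀ : Measure (GaugeConfig d L (Matrix.specialUnitaryGroup (Fin N) ℂ))}
    (hT : ∀ v : Site d L, μ₀.map (configTranslate v) = μ₀) (hP : ∀ π : Equiv.Perm (Fin d), μ₀.map (configPerm π) = μ₀) (t : ℕ)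
    {F : Type*} [NormedAddCommGroup F] [NormedSpace ℝ F] (φ : Matrix.specialUnitaryGroup (Fin N) ℂ → F) {i₀ j₀ : Fin d}
    (h₀ : i₀ ≠ j₀) (x : Site d L) {i j : Fin d} (hij : i ≠ j) :
    ∫ U, φ (plaquetteHolonomy U x i j) ∂(μ₀.bind (nHit (sunLeapfrogHMCN (sunCoordι N) (sunCoordι_skew N) ε
        (Measure.addHaar : Measure (SUNCoords N)) (sunKinetic N)
        (measurable_halfKick_sun N (measurable_sunWilsonForce N (d := d) (L := L) β) ε)
        (fun U => β * wilsonAction (suRep N) U) nstep) t)) =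
      ∫ U, φ (plaquetteHolonomy U 0 i₀ j₀) ∂(μ₀.bind (nHit (sunLeapfrogHMCN (sunCoordι N) (sunCoordι_skew N) ε
        (Measure.addHaar : Measure (SUNCoords N)) (sunKinetic N)
        (measurable_halfKick_sun N (measurable_sunWilsonForce N (d := d) (L := L) β) ε)
        (fun U => β * wilsonAction (suRep N) U) nstep) t)) := by
  -- translate `x` to the origin: `E[φ(U_{x})] = E[φ(U_{(-x)+x})]`
  have h1 := integral_wilsonHmcChain_plaquette_configTranslate N β ε nstep hT t φ i j (-x) x
  rw [neg_add_cancel] at h1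
  rw [h1]
  -- a permutation `π` with `π⁻¹ i₀ = i`, `π⁻¹ j₀ = j`
  obtain ⟨π, hπi, hπj⟩ : ∃ π : Equiv.Perm (Fin d), π i = i₀ ∧ π j = j₀ := by
    classical
    refine ⟨(Equiv.swap i i₀).trans (Equiv.swap ((Equiv.swap i i₀) j) j₀), ?_, ?_⟩
    · simp only [Equiv.trans_apply, Equiv.swap_apply_left]
      rw [Equiv.swap_apply_of_ne_of_ne]
      · intro h
        exact hij ((Equiv.swap i i₀).injective (by rw [Equiv.swap_apply_left]; exact h))
      · intro h
        exact h₀ h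
    · simp only [Equiv.trans_apply, Equiv.swap_apply_left]
  have h2 := integral_wilsonHmcChain_plaquette_configPerm N β ε nstep hP t φ π 0 i₀ j₀
  have hs : sitePerm π.symm (0 : Site d L) = 0 := rfl
  rw [hs, show π.symm i₀ = i from by rw [Equiv.symm_apply_eq]; exact hπi.symm,
    show π.symm j₀ = j from by rw [Equiv.symm_apply_eq]; exact hπj.symm] at h2
  exact h2.symm

/-- **THE LATTICE-AVERAGED PLAQUETTE OF THE PERIODIC RUN HAS THE SINGLE-PLAQUETTE EXPECTATION AT EVERY STEP** (every nonempty
finite family of (site, ordered pair `i ≠ j`); each term integrable for the `t`-step law). -/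
theorem integral_wilsonHmcChain_plaquetteAverage_eq (β ε : ℝ) (nstep : ℕ)
    {μ₀ : Measure (GaugeConfig d L (Matrix.specialUnitaryGroup (Fin N) ℂ))}
    (hT : ∀ v : Site d L, μ₀.map (configTranslate v) = μ₀) (hP : ∀ π : Equiv.Perm (Fin d), μ₀.map (configPerm π) = μ₀) (t : ℕ)
    (φ : Matrix.specialUnitaryGroup (Fin N) ℂ → ℝ) {i₀ j₀ : Fin d} (h₀ : i₀ ≠ j₀)
    (P : Finset (Site d L × {q : Fin d × Fin d // q.1 ≠ q.2})) (hP0 : P.Nonempty)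
    (hint : ∀ p ∈ P, Integrable (fun U : GaugeConfig d L (Matrix.specialUnitaryGroup (Fin N) ℂ) =>
      φ (plaquetteHolonomy U p.1 p.2.1.1 p.2.1.2)) (μ₀.bind (nHit (sunLeapfrogHMCN (sunCoordι N) (sunCoordι_skew N) ε
        (Measure.addHaar : Measure (SUNCoords N)) (sunKinetic N)
        (measurable_halfKick_sun N (measurable_sunWilsonForce N (d := d) (L := L) β) ε)
        (fun U => β * wilsonAction (suRep N) U) nstep) t))) :
    ∫ U, (P.card : ℝ)⁻¹ * ∑ p ∈ P, φ (plaquetteHolonomy U p.1 p.2.1.1 p.2.1.2) ∂(μ₀.bind (nHit (sunLeapfrogHMCN (sunCoordι N)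
        (sunCoordι_skew N) ε (Measure.addHaar : Measure (SUNCoords N)) (sunKinetic N)
        (measurable_halfKick_sun N (measurable_sunWilsonForce N (d := d) (L := L) β) ε)
        (fun U => β * wilsonAction (suRep N) U) nstep) t)) =
      ∫ U, φ (plaquetteHolonomy U 0 i₀ j₀) ∂(μ₀.bind (nHit (sunLeapfrogHMCN (sunCoordι N) (sunCoordι_skew N) ε
        (Measure.addHaar : Measure (SUNCoords N)) (sunKinetic N)
        (measurable_halfKick_sun N (measurable_sunWilsonForce N (d := d) (L := L) β) ε)
        (fun U => β * wilsonAction (suRep N) U) nstep) t)) := by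
  rw [integral_const_mul, integral_finsetSum P hint]
  rw [Finset.sum_congr rfl fun p _ => integral_wilsonHmcChain_plaquette_eq_origin N β ε nstep hT hP t φ h₀ p.1 p.2.2,
    Finset.sum_const, nsmul_eq_mul, ← mul_assoc, inv_mul_cancel₀ (Nat.cast_ne_zero.2 (Finset.card_pos.2 hP0).ne'), one_mul]

/-- Cold start: the averaged plaquette of the periodic run has the single-plaquette expectation at every step. -/
theorem integral_wilsonHmcColdStart_plaquetteAverage_eq (β ε : ℝ) (nstep t : ℕ) (φ : Matrix.specialUnitaryGroup (Fin N) ℂ → ℝ)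
    {i₀ j₀ : Fin d} (h₀ : i₀ ≠ j₀) (P : Finset (Site d L × {q : Fin d × Fin d // q.1 ≠ q.2})) (hP0 : P.Nonempty)
    (hint : ∀ p ∈ P, Integrable (fun U : GaugeConfig d L (Matrix.specialUnitaryGroup (Fin N) ℂ) =>
      φ (plaquetteHolonomy U p.1 p.2.1.1 p.2.1.2)) ((Measure.dirac (1 : GaugeConfig d L (Matrix.specialUnitaryGroup (Fin N) ℂ))).bind
        (nHit (sunLeapfrogHMCN (sunCoordι N) (sunCoordι_skew N) ε (Measure.addHaar : Measure (SUNCoords N)) (sunKinetic N)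
        (measurable_halfKick_sun N (measurable_sunWilsonForce N (d := d) (L := L) β) ε)
        (fun U => β * wilsonAction (suRep N) U) nstep) t))) :
    ∫ U, (P.card : ℝ)⁻¹ * ∑ p ∈ P, φ (plaquetteHolonomy U p.1 p.2.1.1 p.2.1.2)
        ∂((Measure.dirac (1 : GaugeConfig d L (Matrix.specialUnitaryGroup (Fin N) ℂ))).bind (nHit (sunLeapfrogHMCN (sunCoordι N)
          (sunCoordι_skew N) ε (Measure.addHaar : Measure (SUNCoords N)) (sunKinetic N)
          (measurable_halfKick_sun N (measurable_sunWilsonForce N (d := d) (L := L) β) ε)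
          (fun U => β * wilsonAction (suRep N) U) nstep) t)) =
      ∫ U, φ (plaquetteHolonomy U 0 i₀ j₀)
        ∂((Measure.dirac (1 : GaugeConfig d L (Matrix.specialUnitaryGroup (Fin N) ℂ))).bind (nHit (sunLeapfrogHMCN (sunCoordι N)
          (sunCoordι_skew N) ε (Measure.addHaar : Measure (SUNCoords N)) (sunKinetic N)
          (measurable_halfKick_sun N (measurable_sunWilsonForce N (d := d) (L := L) β) ε)
          (fun U => β * wilsonAction (suRep N) U) nstep) t)) :=
  integral_wilsonHmcChain_plaquetteAverage_eq N β ε nstep (fun v => dirac_one_map_configTranslate N v)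
    (fun π => dirac_one_map_configPerm_sun N π) t φ h₀ P hP0 hint

/-- Hot start: the averaged plaquette of the periodic run has the single-plaquette expectation at every step. -/
theorem integral_wilsonHmcHotStart_plaquetteAverage_eq (β ε : ℝ) (nstep t : ℕ) (φ : Matrix.specialUnitaryGroup (Fin N) ℂ → ℝ)
    {i₀ j₀ : Fin d} (h₀ : i₀ ≠ j₀) (P : Finset (Site d L × {q : Fin d × Fin d // q.1 ≠ q.2})) (hP0 : P.Nonempty)
    (hint : ∀ p ∈ P, Integrable (fun U : GaugeConfig d L (Matrix.specialUnitaryGroup (Fin N) ℂ) =>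
      φ (plaquetteHolonomy U p.1 p.2.1.1 p.2.1.2))
      ((Measure.pi fun _ : Edge d L => haarProbability (Matrix.specialUnitaryGroup (Fin N) ℂ)).bind
        (nHit (sunLeapfrogHMCN (sunCoordι N) (sunCoordι_skew N) ε (Measure.addHaar : Measure (SUNCoords N)) (sunKinetic N)
        (measurable_halfKick_sun N (measurable_sunWilsonForce N (d := d) (L := L) β) ε)
        (fun U => β * wilsonAction (suRep N) U) nstep) t))) :
    ∫ U, (P.card : ℝ)⁻¹ * ∑ p ∈ P, φ (plaquetteHolonomy U p.1 p.2.1.1 p.2.1.2)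
        ∂((Measure.pi fun _ : Edge d L => haarProbability (Matrix.specialUnitaryGroup (Fin N) ℂ)).bind (nHit (sunLeapfrogHMCN
          (sunCoordι N) (sunCoordι_skew N) ε (Measure.addHaar : Measure (SUNCoords N)) (sunKinetic N)
          (measurable_halfKick_sun N (measurable_sunWilsonForce N (d := d) (L := L) β) ε)
          (fun U => β * wilsonAction (suRep N) U) nstep) t)) =
      ∫ U, φ (plaquetteHolonomy U 0 i₀ j₀)
        ∂((Measure.pi fun _ : Edge d L => haarProbability (Matrix.specialUnitaryGroup (Fin N) ℂ)).bind (nHit (sunLeapfrogHMCN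
          (sunCoordι N) (sunCoordι_skew N) ε (Measure.addHaar : Measure (SUNCoords N)) (sunKinetic N)
          (measurable_halfKick_sun N (measurable_sunWilsonForce N (d := d) (L := L) β) ε)
          (fun U => β * wilsonAction (suRep N) U) nstep) t)) :=
  integral_wilsonHmcChain_plaquetteAverage_eq N β ε nstep (fun v => piHaar_map_configTranslate N v)
    (fun π => piHaar_map_configPerm_sun N π) t φ h₀ P hP0 hint

end Homogeneity

end Summit.Ventures.LatticeQCDFlow.Exactness
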